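import Summits.MatrixMultiplication.MatrixMultiplication.Theorems.LevelGradedCohnUmansLevelOneGL2DesignsTangencyParabolaLift
import Summits.MatrixMultiplication.MatrixMultiplication.Theorems.LevelGradedCohnUmansLevelOneGL2DesignsTangencyQuadraticLiftDigits

/-!
# The quadratic-order parabola lift (wall-breaker axis `parabola lifts over finite fields`, stub
`stub_tangencySets` of the crux `LevelOneGL2Designs`, stmt-MatrixMultiplication-14080)

Let `p` be a prime in which a fixed non-square integer `κ` is a quadratic residue, `K² = κ (mod p)`, and code the
order `ℤ[√κ]` into `𝔽_p` by `(x, y) ↦ x + K y`.  The parabola lift (`srs_of_sqDiff_disjoint` of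
`…TangencyParabolaLift`) of the parameter sets `A = {a₁ + K a₂ : a ∈ [0,M₁) × [0,M₂)}` and `T̃ = {t₁ + K t₂ :
t ∈ T}`, `T ⊆ [0,N)²` with no two elements differing by a non-trivial square of `ℤ[√κ]`
(`…TangencyQuadraticLiftDigits`), is a strong representative system of `AG(2,p)`: the incidence identity
`(a − a')² = t − t'` becomes `(d₁² + κ d₂² − e₁) + K (2 d₁ d₂ − e₂) = 0` for the digitwise differences `d, e`, and
for `M ≍ p^{1/4}`, `N ≍ p^{1/2}` the two brackets are so small that the norm form forces them to vanish in `ℤ`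
(`quadDigits_eq_zero`), i.e. `e = d²` in `ℤ[√κ]` — excluded.  With digit sets of density exponent `3/4` this is
`|A|·|T| ≍ p^{1/2} · p^{3/4} = p^{5/4}` flags.

* `srs_of_quadLift` — the construction for general boxes, under the size hypothesis `hsize`;
* `exists_srs_quadLift` — the generic assembly: from the finite data `(κ, q, R)`, `|R| = q`, and a square root `K`
  of `κ` modulo `p > C q⁴` (`C = (2+|κ|)² + 9|κ|`), an SRS `F` and `x ≥ 2` with `x⁵ ≤ 2|F|`, `p ≤ C q⁴ x⁴`
  (so `|F| ≥ p^{5/4} / (2 (C q⁴)^{5/4})`).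

The instances `κ ∈ {−1, 2, −2}` (one of which is a residue modulo every prime) and the unconditional `p^{5/4}`
theorem for ALL primes are in `…TangencyQuadraticLiftAllPrimes`; the Gaussian case `p ≡ 1 (4)` alone is also seat
k2's `…GaussLift`.  New; the integer case is HPVZ 2026 Prop. 2.3, and Pohoata (2026, arXiv:2607.20422, Prop. 5.1)
lifts instead the trace-zero slice of a totally real field of degree `d` (exponent `3/2 − 1/d` for the primes
split in it).  Elementary and fully proved; no definitions. [cite: HunterPohoataVerstraeteZhang2026, Prop. 2.3]
-/

-- the summit/problem path `MatrixMultiplication.MatrixMultiplication` is fixed by the tree layout (D-0017)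
set_option linter.dupNamespace false

noncomputable section

open Finset Matrix

namespace Summit.MatrixMultiplication.MatrixMultiplication.Theorems.LevelOneGL2Designs.ParabolaLift

section Lift

variable {p : ℕ} [Fact p.Prime]

/-- **The quadratic-order parabola lift (construction).**  Let `K² = κ` in `ZMod p`, `κ ∈ ℤ` not a perfect
square, and code `ℤ[√κ] → ZMod p` by `(x, y) ↦ x + K·y`.  Lift the digit box `[0,M₁) × [0,M₂)` to parabola
parameters `a = a₁ + K a₂` and a set `T ⊆ [0,N)²` with no two elements differing by a non-trivial square of
`ℤ[√κ]` to shifts `t = t₁ + K t₂`; attach to `(a, t)` the point `(a, a² + t)` and the tangent of `y = x² + t`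
there (`srs_of_sqDiff_disjoint`).  The incidence identity `(a − a')² = t − t'` of the parabola lift reads, with
`d = a − a'`, `e = t − t'` (digitwise), `(d₁² + κ d₂² − e₁) + K·(2 d₁ d₂ − e₂) = 0`; if the box is small
(`hsize`: the norm form `u² − κ v²` of these two brackets stays below `p`) both brackets vanish in `ℤ`
(`quadDigits_eq_zero`), i.e. `e = d²` in `ℤ[√κ]`, so `e = 0` and `d = 0`.  Hence `≥ M₁ M₂ |T| − 2|T|` flags
forming a strong representative system of `AG(2,p)` in the format of `stub_tangencySets`.  (For `κ = −1` this
is a "Gaussian parabola lift"; Hunter–Pohoata–Verstraëte–Zhang 2026 lift from `ℤ`, Pohoata 2026 from totally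
real fields with the trace-zero slice in place of `T`.) [elementary; new] -/
theorem srs_of_quadLift {κ : ℤ} (hκ : ¬ IsSquare κ) {K : ZMod p} (hK : K ^ 2 = (κ : ZMod p))
    (M₁ M₂ N : ℕ) (T : Finset (ℕ × ℕ)) (hTN : ∀ t ∈ T, t.1 < N ∧ t.2 < N)
    (hT : ∀ a ∈ T, ∀ b ∈ T, ∀ n₁ n₂ : ℤ, (a.1 : ℤ) = b.1 + (n₁ ^ 2 + κ * n₂ ^ 2) →
      (a.2 : ℤ) = b.2 + 2 * n₁ * n₂ → a = b)
    (hsize : ∀ u v : ℤ, |u| ≤ (M₁ : ℤ) ^ 2 + |κ| * (M₂ : ℤ) ^ 2 + N →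
      |v| ≤ 2 * (M₁ : ℤ) * M₂ + N → |u ^ 2 - κ * v ^ 2| < p) :
    ∃ F : Finset ((Fin 2 → ZMod p) × (Fin 2 → ZMod p)),
      M₁ * M₂ * T.card ≤ F.card + 2 * T.card ∧
      ∀ f ∈ F, ∀ f' ∈ F, (dotProduct f.1 f'.2 = 1 ↔ f = f') := by
  classical
  let enc : ℕ × ℕ → ZMod p := fun a => (a.1 : ZMod p) + K * a.2
  have henc : ∀ a : ℕ × ℕ, enc a = (a.1 : ZMod p) + K * a.2 := fun a => rfl
  -- the norm argument, packaged: small `u, v` with `u + K v = 0` vanish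
  have vanish : ∀ u v : ℤ, |u| ≤ (M₁ : ℤ) ^ 2 + |κ| * (M₂ : ℤ) ^ 2 + N →
      |v| ≤ 2 * (M₁ : ℤ) * M₂ + N → (u : ZMod p) + K * v = 0 → u = 0 ∧ v = 0 :=
    fun u v hu hv h => quadDigits_eq_zero hκ hK (hsize u v hu hv) h
  have hM1sq : (M₁ : ℤ) ≤ (M₁ : ℤ) ^ 2 := by exact_mod_cast Nat.le_self_pow two_ne_zero M₁
  have hκ0 : (0 : ℤ) ≤ |κ| * (M₂ : ℤ) ^ 2 := by positivity
  -- injectivity of the coding on the digit box and on `T`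
  have injA : Set.InjOn enc ↑((range M₁) ×ˢ (range M₂)) := by
    rintro ⟨a₁, a₂⟩ ha ⟨b₁, b₂⟩ hb h
    simp only [coe_product, Set.mem_prod, mem_coe, mem_range] at ha hb
    have ha1 : (a₁ : ℤ) < M₁ := by exact_mod_cast ha.1
    have ha2 : (a₂ : ℤ) < M₂ := by exact_mod_cast ha.2
    have hb1 : (b₁ : ℤ) < M₁ := by exact_mod_cast hb.1
    have hb2 : (b₂ : ℤ) < M₂ := by exact_mod_cast hb.2
    have hM1 : (1 : ℤ) ≤ M₁ := by linarith
    have hN0 : (0 : ℤ) ≤ N := by positivity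
    have h0 : (((a₁ : ℤ) - b₁ : ℤ) : ZMod p) + K * (((a₂ : ℤ) - b₂ : ℤ) : ZMod p) = 0 := by
      rw [henc, henc] at h
      push_cast
      linear_combination h
    obtain ⟨e1, e2⟩ := vanish _ _ (abs_le.mpr ⟨by nlinarith, by nlinarith⟩)
      (abs_le.mpr ⟨by nlinarith, by nlinarith⟩) h0
    have h1 : a₁ = b₁ := by omega
    have h2 : a₂ = b₂ := by omega
    rw [h1, h2]
  have injT : Set.InjOn enc ↑T := by
    rintro ⟨a₁, a₂⟩ ha ⟨b₁, b₂⟩ hb h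
    rw [mem_coe] at ha hb
    have ha1 : a₁ < N := (hTN _ ha).1
    have ha2 : a₂ < N := (hTN _ ha).2
    have hb1 : b₁ < N := (hTN _ hb).1
    have hb2 : b₂ < N := (hTN _ hb).2
    have hM0 : (0 : ℤ) ≤ 2 * (M₁ : ℤ) * M₂ := by positivity
    have hM0' : (0 : ℤ) ≤ (M₁ : ℤ) ^ 2 := by positivity
    have h0 : (((a₁ : ℤ) - b₁ : ℤ) : ZMod p) + K * (((a₂ : ℤ) - b₂ : ℤ) : ZMod p) = 0 := by
      rw [henc, henc] at h
      push_cast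
      linear_combination h
    obtain ⟨e1, e2⟩ := vanish _ _ (abs_le.mpr ⟨by omega, by omega⟩)
      (abs_le.mpr ⟨by omega, by omega⟩) h0
    have h1 : a₁ = b₁ := by omega
    have h2 : a₂ = b₂ := by omega
    rw [h1, h2]
  -- the incidence identity of the lift, decided in `ℤ[√κ]`
  have key : ∀ t ∈ ((range M₁) ×ˢ (range M₂)).image enc, ∀ s ∈ T.image enc,
      ∀ t' ∈ ((range M₁) ×ˢ (range M₂)).image enc, ∀ s' ∈ T.image enc,
      (t - t') ^ 2 = s - s' → t = t' ∧ s = s' := by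
    simp only [mem_image, mem_product, mem_range]
    rintro _ ⟨⟨a₁, a₂⟩, ⟨ha1, ha2⟩, rfl⟩ _ ⟨⟨t₁, t₂⟩, ht, rfl⟩ _ ⟨⟨b₁, b₂⟩, ⟨hb1, hb2⟩, rfl⟩
      _ ⟨⟨s₁, s₂⟩, hs, rfl⟩ h
    have ht1 : t₁ < N := (hTN _ ht).1
    have ht2 : t₂ < N := (hTN _ ht).2
    have hs1 : s₁ < N := (hTN _ hs).1
    have hs2 : s₂ < N := (hTN _ hs).2
    have h0 : ((((a₁ : ℤ) - b₁) ^ 2 + κ * ((a₂ : ℤ) - b₂) ^ 2 - ((t₁ : ℤ) - s₁) : ℤ) : ZMod p)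
        + K * (((2 * ((a₁ : ℤ) - b₁) * ((a₂ : ℤ) - b₂) - ((t₂ : ℤ) - s₂)) : ℤ) : ZMod p) = 0 := by
      rw [henc, henc, henc, henc] at h
      push_cast
      linear_combination h - (((a₂ : ZMod p) - b₂) ^ 2) * hK
    -- size bounds on the two brackets
    have hd1 : |(a₁ : ℤ) - b₁| ≤ M₁ := abs_le.mpr ⟨by omega, by omega⟩
    have hd2 : |(a₂ : ℤ) - b₂| ≤ M₂ := abs_le.mpr ⟨by omega, by omega⟩
    have hd1sq : ((a₁ : ℤ) - b₁) ^ 2 ≤ (M₁ : ℤ) ^ 2 := by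
      calc ((a₁ : ℤ) - b₁) ^ 2 = |(a₁ : ℤ) - b₁| ^ 2 := (sq_abs _).symm
        _ ≤ (M₁ : ℤ) ^ 2 := pow_le_pow_left₀ (abs_nonneg _) hd1 2
    have hd2sq : ((a₂ : ℤ) - b₂) ^ 2 ≤ (M₂ : ℤ) ^ 2 := by
      calc ((a₂ : ℤ) - b₂) ^ 2 = |(a₂ : ℤ) - b₂| ^ 2 := (sq_abs _).symm
        _ ≤ (M₂ : ℤ) ^ 2 := pow_le_pow_left₀ (abs_nonneg _) hd2 2
    have hk : |κ * ((a₂ : ℤ) - b₂) ^ 2| ≤ |κ| * (M₂ : ℤ) ^ 2 := by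
      rw [abs_mul, abs_of_nonneg (sq_nonneg ((a₂ : ℤ) - b₂))]
      exact mul_le_mul_of_nonneg_left hd2sq (abs_nonneg κ)
    obtain ⟨hk1, hk2⟩ := abs_le.mp hk
    have hprod : |2 * ((a₁ : ℤ) - b₁) * ((a₂ : ℤ) - b₂)| ≤ 2 * (M₁ : ℤ) * M₂ := by
      rw [abs_mul, abs_mul, abs_two]
      gcongr
    obtain ⟨hp1, hp2⟩ := abs_le.mp hprod
    have hsq0 : (0 : ℤ) ≤ ((a₁ : ℤ) - b₁) ^ 2 := sq_nonneg _
    obtain ⟨e1, e2⟩ := vanish _ _ (abs_le.mpr ⟨by omega, by omega⟩)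
      (abs_le.mpr ⟨by omega, by omega⟩) h0
    -- `e = d²` in `ℤ[√κ]`: so `t = s` …
    have hts : ((t₁, t₂) : ℕ × ℕ) = (s₁, s₂) :=
      hT _ ht _ hs ((a₁ : ℤ) - b₁) ((a₂ : ℤ) - b₂) (by push_cast; linarith) (by push_cast; linarith)
    simp only [Prod.mk.injEq] at hts
    obtain ⟨rfl, rfl⟩ := hts
    -- … and `d² = 0`, so `d = 0` (`κ ≠ 0`)
    have hsq : ((a₁ : ℤ) - b₁) ^ 2 + κ * ((a₂ : ℤ) - b₂) ^ 2 = 0 := by linarith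
    have hpr : 2 * ((a₁ : ℤ) - b₁) * ((a₂ : ℤ) - b₂) = 0 := by linarith
    have hκne : κ ≠ 0 := fun h0 => hκ (h0 ▸ IsSquare.zero)
    have hab : (a₁ : ℤ) - b₁ = 0 ∧ (a₂ : ℤ) - b₂ = 0 := by
      rcases mul_eq_zero.mp hpr with h1 | h2
      · rcases mul_eq_zero.mp h1 with h3 | h3
        · norm_num at h3
        · refine ⟨h3, ?_⟩
          have h4 : κ * ((a₂ : ℤ) - b₂) ^ 2 = 0 := by rw [h3] at hsq; linear_combination hsq
          rcases mul_eq_zero.mp h4 with h5 | h5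
          · exact absurd h5 hκne
          · exact pow_eq_zero_iff two_ne_zero |>.mp h5
      · refine ⟨?_, h2⟩
        have h4 : ((a₁ : ℤ) - b₁) ^ 2 = 0 := by rw [h2] at hsq; linear_combination hsq
        exact pow_eq_zero_iff two_ne_zero |>.mp h4
    obtain ⟨h5, h6⟩ := hab
    have h7 : a₁ = b₁ := by omega
    have h8 : a₂ = b₂ := by omega
    subst h7; subst h8
    exact ⟨rfl, rfl⟩
  obtain ⟨F, hF, hsrs⟩ :=
    srs_of_sqDiff_disjoint (((range M₁) ×ˢ (range M₂)).image enc) (T.image enc) key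
  refine ⟨F, ?_, hsrs⟩
  rw [card_image_of_injOn injA, card_image_of_injOn injT, card_product, card_range,
    card_range] at hF
  exact hF

/-- **Generic assembly of the quadratic lift.**  Fix the data of an order `ℤ[√κ]` (`κ` a non-square), a
prime `q ≥ 2` of it in decidable form, and a set `R` of `q` residues modulo `q` with no square differences (all
hypotheses are finite checks).  Then for every prime `p > C·q⁴`, `C = (2 + |κ|)² + 9|κ|`, in which `κ` is a
square there is a strong representative system `F` of `AG(2,p)` (stub format) and an integer `x ≥ 2` with
`x⁵ ≤ 2|F|` and `p ≤ C q⁴ · x⁴` — whence `|F| ≥ p^{5/4} / (2 (C q⁴)^{5/4})`.  (Take `x = q^k` maximal with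
`C x⁴ < p`, digits `[0,x)²`, `T ⊆ [0,x²)²` the `k`-fold digit set of size `x³`.) [elementary; new] -/
theorem exists_srs_quadLift (κ : ℤ) (hκ : ¬ IsSquare κ) (q : ℕ) (hq : 2 ≤ q)
    (hprime : ∀ x y : ZMod q, x ^ 2 + (κ : ZMod q) * y ^ 2 = 0 → 2 * x * y = 0 → x = 0 ∧ y = 0)
    (R : Finset (ℕ × ℕ)) (hRq : ∀ r ∈ R, r.1 < q ∧ r.2 < q)
    (hR : ∀ r ∈ R, ∀ r' ∈ R, ∀ x y : ZMod q,
      x ^ 2 + (κ : ZMod q) * y ^ 2 + (r'.1 : ZMod q) = r.1 → 2 * x * y + (r'.2 : ZMod q) = r.2 → r = r')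
    (hRcard : R.card = q) {K : ZMod p} (hK : K ^ 2 = (κ : ZMod p))
    (hp : ((2 + κ.natAbs) ^ 2 + 9 * κ.natAbs) * q ^ 4 < p) :
    ∃ F : Finset ((Fin 2 → ZMod p) × (Fin 2 → ZMod p)),
      (∀ f ∈ F, ∀ f' ∈ F, (dotProduct f.1 f'.2 = 1 ↔ f = f')) ∧
      ∃ x : ℕ, 2 ≤ x ∧ x ^ 5 ≤ 2 * F.card ∧
        p ≤ ((2 + κ.natAbs) ^ 2 + 9 * κ.natAbs) * q ^ 4 * x ^ 4 := by
  set C : ℕ := (2 + κ.natAbs) ^ 2 + 9 * κ.natAbs with hC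
  have hC0 : 0 < C := by rw [hC]; positivity
  have hq4 : 1 < q ^ 4 := lt_of_lt_of_le (by norm_num) (Nat.pow_le_pow_left hq 4)
  set k := Nat.log (q ^ 4) ((p - 1) / C) with hk
  set x := q ^ k with hx
  -- `C · q^{4k} ≤ p − 1 < C · q^{4k+4}`
  have h1 : q ^ 4 ≤ (p - 1) / C := by
    rw [Nat.le_div_iff_mul_le hC0]
    have := hp
    rw [mul_comm] at this
    omega
  have hk1 : 0 < k := Nat.log_pos hq4 h1
  have hne : (p - 1) / C ≠ 0 := by
    intro h0; rw [h0] at h1; omega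
  have h2 : (q ^ 4) ^ k ≤ (p - 1) / C := Nat.pow_log_le_self _ hne
  have h3 : (p - 1) / C < (q ^ 4) ^ (k + 1) := Nat.lt_pow_succ_log_self hq4 _
  have hx4 : x ^ 4 = (q ^ 4) ^ k := by rw [hx, ← pow_mul, ← pow_mul, mul_comm]
  have hdm := Nat.div_add_mod (p - 1) C
  have hml := Nat.mod_lt (p - 1) hC0
  have hp1 : 1 ≤ p := by omega
  have hCx : C * x ^ 4 < p := by
    rw [hx4]
    have h5 : C * (q ^ 4) ^ k ≤ C * ((p - 1) / C) := Nat.mul_le_mul_left C h2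
    calc C * (q ^ 4) ^ k ≤ C * ((p - 1) / C) := h5
      _ ≤ C * ((p - 1) / C) + (p - 1) % C := Nat.le_add_right _ _
      _ = p - 1 := hdm
      _ < p := by omega
  have hpx : p ≤ C * q ^ 4 * x ^ 4 := by
    have e : (q ^ 4) ^ (k + 1) = q ^ 4 * x ^ 4 := by rw [pow_succ, hx4, mul_comm]
    rw [e] at h3
    have h5 : C * ((p - 1) / C + 1) ≤ C * (q ^ 4 * x ^ 4) := Nat.mul_le_mul_left C h3
    have h6 : p = C * ((p - 1) / C) + (p - 1) % C + 1 := by omega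
    calc p = C * ((p - 1) / C) + (p - 1) % C + 1 := h6
      _ ≤ C * ((p - 1) / C) + C := by omega
      _ = C * ((p - 1) / C + 1) := by ring
      _ ≤ C * (q ^ 4 * x ^ 4) := h5
      _ = C * q ^ 4 * x ^ 4 := by ring
  have hx2 : 2 ≤ x := le_trans hq (hx ▸ Nat.le_self_pow hk1.ne' q)
  -- the digit set
  obtain ⟨T, hTN, hTcard, hT⟩ :=
    exists_quadSqDiffFree_digits κ q (by omega) hprime R hRq hR k
  have hN : q ^ (2 * k) = x ^ 2 := by rw [hx, ← pow_mul, mul_comm]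
  rw [hN] at hTN
  have hT3 : T.card = x ^ 3 := by
    rw [hTcard, hRcard, hx, ← pow_mul]
    ring
  -- the size hypothesis of the lift
  have habsκ : ((κ.natAbs : ℕ) : ℤ) = |κ| := Int.natCast_natAbs κ
  have hCx' : ((2 + |κ|) ^ 2 + 9 * |κ|) * (x : ℤ) ^ 4 < p := by
    have h' : ((C * x ^ 4 : ℕ) : ℤ) < p := by exact_mod_cast hCx
    rw [hC] at h'
    push_cast at h'
    simpa only [habsκ] using h'
  have hsize : ∀ u v : ℤ, |u| ≤ (x : ℤ) ^ 2 + |κ| * (x : ℤ) ^ 2 + (x ^ 2 : ℕ) →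
      |v| ≤ 2 * (x : ℤ) * x + (x ^ 2 : ℕ) → |u ^ 2 - κ * v ^ 2| < p := by
    intro u v hu hv
    push_cast at hu hv
    have hκ0 : (0 : ℤ) ≤ |κ| := abs_nonneg κ
    have hu' : |u| ≤ (2 + |κ|) * (x : ℤ) ^ 2 := by linarith
    have hv' : |v| ≤ 3 * (x : ℤ) ^ 2 := by linarith
    have hu2 : u ^ 2 ≤ ((2 + |κ|) * (x : ℤ) ^ 2) ^ 2 := by
      calc u ^ 2 = |u| ^ 2 := (sq_abs _).symm
        _ ≤ ((2 + |κ|) * (x : ℤ) ^ 2) ^ 2 := pow_le_pow_left₀ (abs_nonneg _) hu' 2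
    have hv2 : v ^ 2 ≤ (3 * (x : ℤ) ^ 2) ^ 2 := by
      calc v ^ 2 = |v| ^ 2 := (sq_abs _).symm
        _ ≤ (3 * (x : ℤ) ^ 2) ^ 2 := pow_le_pow_left₀ (abs_nonneg _) hv' 2
    have hkv : |κ * v ^ 2| ≤ |κ| * (3 * (x : ℤ) ^ 2) ^ 2 := by
      rw [abs_mul, abs_of_nonneg (sq_nonneg v)]
      exact mul_le_mul_of_nonneg_left hv2 (abs_nonneg κ)
    calc |u ^ 2 - κ * v ^ 2| ≤ |u ^ 2| + |κ * v ^ 2| := abs_sub _ _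
      _ ≤ ((2 + |κ|) * (x : ℤ) ^ 2) ^ 2 + |κ| * (3 * (x : ℤ) ^ 2) ^ 2 := by
          rw [abs_of_nonneg (sq_nonneg u)]; gcongr
      _ = ((2 + |κ|) ^ 2 + 9 * |κ|) * (x : ℤ) ^ 4 := by ring
      _ < p := hCx'
  obtain ⟨F, hF, hsrs⟩ := srs_of_quadLift hκ hK x x (x ^ 2) T hTN hT hsize
  refine ⟨F, hsrs, x, hx2, ?_, hpx⟩
  rw [hT3] at hF
  have h4 : 4 ≤ x ^ 2 := by nlinarith
  have h4x : 4 * x ^ 3 ≤ x ^ 5 := by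
    calc 4 * x ^ 3 ≤ x ^ 2 * x ^ 3 := Nat.mul_le_mul_right _ h4
      _ = x ^ 5 := by ring
  have h5 : x ^ 5 = x * x * x ^ 3 := by ring
  linarith

end Lift

end Summit.MatrixMultiplication.MatrixMultiplication.Theorems.LevelOneGL2Designs.ParabolaLift
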